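import Summits.RiemannHypothesis.RiemannHypothesis.Theses.GapsEvoDoors
import Summits.RiemannHypothesis.RiemannHypothesis.Theorems.GapsEvoDoorsMTFourier
import Summits.RiemannHypothesis.RiemannHypothesis.Theorems.GapsEvoDoorsMTIntegrals

/-!
# GapsEvoDoors — `MultCertificateRecord` (item stmt-RiemannHypothesis-23131): the door-(a″) certificate of record

Route `GapsEvoDoors`, support `MultCertificateRecord` (instance `(Δ_s, ν_s) = (53/50, 1293/1000)`
of the cell's multiplicity certificate, PREREG-GAPS-7 A2): an admissible multiplicity majorant `g`
(even, continuous, `L¹`, `ĝ ∈ L¹`, `g ≥ 0`, `g(0) = 1`, `ĝ ≤ 0` for `|α| ≥ 53/50`) with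
`m(g; 53/50, ε) ≤ 1.293 + κε` for all `ε ≥ 0`.

WITNESS (closed form, kernel-certified): the Montgomery–Taylor cosine majorant of
`GapsEvoDoorsMTDefs.lean` — `g = h²/h(0)²`, `h = 𝓕ĥ`, `ĥ(x) = cos(πx/2)𝟙_{|x| ≤ 53/100}`, with
`ĝ = (ĥ ∗ ĥ)/h(0)²` supported in `[−53/50, 53/50]` and `≥ 0` on `[1, 53/50]`
(`GapsEvoDoorsMTFourier.lean`, `GapsEvoDoorsMTIntegrals.lean`), so
`m(g; 53/50, ε) = m(g; 53/50, 0) + κε` with `κ = 2∫₁^{53/50} ĝ ≈ 0.00196` and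
`m(g; 53/50, 0) = π²(53/100 + cos θ/π + (4 sin θ − 6/25)/π² + (16 + 8 sin θ − 8 cos θ)/π³)/(8(1 + sin θ))`
`= 1.29014 ≤ 1.293` (`θ = 3π/100`; `certificate_le`). For the cell's books: this closed-form
object lies BELOW both engines' class optima at the same window (eng-2 PW-SOS n = 18: 1.290483;
eng-1 HGM: 1.292900; both classes force `ĥ(±Δ/2) = 0`), and at `Δ = 1` the same family gives the
Montgomery–Taylor/Cheer–Goldston constant `1.3275`; with `c = √2` instead of `π/2` it reaches
`1.28970`. RH-sentence (c): a record INSIDE route GapsEvoDoors (door (a″), RECORD class; with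
`FFMultiplicityCriterionAll` and `SimpleFromNStar`: «RH + F → 1 on (1, 1.06] ⇒ ≥ 70.7 % of the
zeros are simple») — toward RiemannHypothesis: 0. computed ≠ proved outside this kernel theorem;
nothing here bears on the truth of RH.
-/

noncomputable section

open Filter Set MeasureTheory Real Literature.NumberTheory.LFunctions
open Literature.NumberTheory.LFunctions.BGMM2023
open Summit.RiemannHypothesis.RiemannHypothesis.Theorems.GapsEvoDoorsMT

set_option linter.dupNamespace false  -- the mandated namespace repeats `RiemannHypothesis`

namespace Summit.RiemannHypothesis.RiemannHypothesis.Theorems.GapsEvoDoorsMultCert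

/-- `h(0)² > 0` (`= 8(1 + sin(3π/100))/π²`). -/
theorem mtProfile_zero_sq_pos : 0 < mtProfile 0 ^ 2 := by
  rw [mtProfile_zero_sq]
  have hs : 0 ≤ Real.sin (3 * π / 100) :=
    Real.sin_nonneg_of_nonneg_of_le_pi (by positivity) (by linarith [Real.pi_pos])
  positivity

/-- **`ĝ = G/h(0)²`**: the cosine transform of the majorant is the normalised autocorrelation. -/
theorem cosTransform_mtMajorant (α : ℝ) : cosTransform mtMajorant α = mtAuto α / mtProfile 0 ^ 2 := by
  rw [← cosTransform_mtProfile_sq α]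
  unfold cosTransform mtMajorant
  rw [← integral_div]
  refine integral_congr_ae (Eventually.of_forall fun u ↦ ?_)
  simp only
  ring

/-- **`MultCertificateRecord` holds** (item stmt-RiemannHypothesis-23131 of route GapsEvoDoors),
witnessed by the Montgomery–Taylor majorant `g = mtMajorant` with `κ = 2∫₁^{53/50} ĝ`: the seven
admissibility clauses (`GapsEvoDoorsMTFourier.lean`) and `m(g; 53/50, ε) = m(g; 53/50, 0) + κε ≤
1.293 + κε` (`certificate_le`, `GapsEvoDoorsMTIntegrals.lean`). A record INSIDE the route
(door (a″)); toward RiemannHypothesis: 0. -/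
theorem MultCertificateRecord_holds :
    Summit.RiemannHypothesis.RiemannHypothesis.Theses.GapsEvoDoors.MultCertificateRecord := by
  unfold Summit.RiemannHypothesis.RiemannHypothesis.Theses.GapsEvoDoors.MultCertificateRecord
  have hC := mtProfile_zero_sq_pos
  have hct : cosTransform mtMajorant = fun α ↦ mtAuto α / mtProfile 0 ^ 2 :=
    funext cosTransform_mtMajorant
  refine ⟨mtMajorant, fun u ↦ ?_, (continuous_mtProfile.pow 2).div_const _,
    integrable_mtProfile_sq.div_const _, ?_, fun u ↦ div_nonneg (sq_nonneg _) (sq_nonneg _), ?_, ?_,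
    2 * (∫ α in (1 : ℝ)..(53 / 50), mtAuto α) / mtProfile 0 ^ 2,
    div_nonneg (mul_nonneg zero_le_two integral_mtAuto_window_nonneg) hC.le, fun ε hε ↦ ?_⟩
  · -- even
    unfold mtMajorant; rw [mtProfile_neg]
  · -- `ĝ ∈ L¹`
    rw [hct]; exact integrable_mtAuto.div_const _
  · -- `g(0) = 1`
    unfold mtMajorant; exact div_self hC.ne'
  · -- `ĝ ≤ 0` (indeed `= 0`) beyond the window
    intro α hα
    rw [cosTransform_mtMajorant, mtAuto_eq_zero hα, zero_div]
  · -- the certificate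
    rw [hct]
    simp only
    have h1 : ∫ α in (0 : ℝ)..1, α * (mtAuto α / mtProfile 0 ^ 2) =
        (∫ α in (0 : ℝ)..1, α * mtAuto α) / mtProfile 0 ^ 2 := by
      rw [← intervalIntegral.integral_div]
      refine intervalIntegral.integral_congr fun α _ ↦ ?_
      ring
    have h2 : ∫ α in (1 : ℝ)..(53 / 50), ((1 + ε) * max (mtAuto α / mtProfile 0 ^ 2) 0 -
        (1 - ε) * max (-(mtAuto α / mtProfile 0 ^ 2)) 0) =
        (1 + ε) / mtProfile 0 ^ 2 * ∫ α in (1 : ℝ)..(53 / 50), mtAuto α := by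
      rw [← intervalIntegral.integral_const_mul]
      refine intervalIntegral.integral_congr fun α hα ↦ ?_
      rw [Set.uIcc_of_le (by norm_num), Set.mem_Icc] at hα
      have hG : 0 ≤ mtAuto α / mtProfile 0 ^ 2 :=
        div_nonneg (mtAuto_nonneg_of_mem_window hα.1 hα.2) hC.le
      rw [max_eq_left hG, max_eq_right (by linarith), mul_zero, sub_zero]
      ring
    rw [h1, h2]
    have hcert := certificate_le
    have h3 : (mtAuto 0 + 2 * (∫ α in (0 : ℝ)..1, α * mtAuto α) +
        2 * (∫ α in (1 : ℝ)..(53 / 50), mtAuto α)) / mtProfile 0 ^ 2 ≤ 1293 / 1000 := by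
      rw [div_le_iff₀ hC]; exact hcert
    have e : mtAuto 0 / mtProfile 0 ^ 2 + 2 * ((∫ α in (0 : ℝ)..1, α * mtAuto α) / mtProfile 0 ^ 2) +
        2 * ((1 + ε) / mtProfile 0 ^ 2 * ∫ α in (1 : ℝ)..(53 / 50), mtAuto α) =
        (mtAuto 0 + 2 * (∫ α in (0 : ℝ)..1, α * mtAuto α) +
          2 * (∫ α in (1 : ℝ)..(53 / 50), mtAuto α)) / mtProfile 0 ^ 2 +
        2 * (∫ α in (1 : ℝ)..(53 / 50), mtAuto α) / mtProfile 0 ^ 2 * ε := by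
      field_simp
      ring
    rw [e]
    linarith

end Summit.RiemannHypothesis.RiemannHypothesis.Theorems.GapsEvoDoorsMultCert

end
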